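import Literature.Analysis.FluidPDE.KwonHarmonicPart
import Literature.Analysis.FluidPDE.KwonLocalLerayDuality
import HarnessLib

/-!
# Kwon's harmonic part: sup bound for the second derivatives ((est.h) at order two)

Analysis/FluidPDE proof file (theorems only) on the discharge path of the named fact
`Literature.Analysis.FluidPDE.kwon2023_velocity_epsilon_regularity`
(`PressureFreeEpsilonRegularity.lean`; H. Kwon, J. Differential Equations (2023) =
arXiv:2104.03160, Thm. 1.4). Kwon's Lemma 2.5 uses `‖∇ᵏh‖_{L^∞(B₁)} ≲ ‖u‖_{L¹(B₂)}` for
`0 ≤ k ≤ 2` ((est.h); Remark 2.3, (2.4)); the tree has `k = 0, 1`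
(`exists_norm(_fderiv)_harmonicPart_le`, `KwonHarmonicPart`). This file adds `k = 2`, needed for
`‖h‖_{W^{2,∞}}` in the bound of the self-interaction force `curl Δ⁻¹ curl(curl h × h φ♭)`:

* `norm_fderiv_fderiv_convolution_le`: `‖D²(κ ⋆ g)(x)‖ ≤ K ‖g‖_{L¹}` for a kernel `κ ∈ C²_c`
  with `‖∂ₐ∂_bκ‖ ≤ K|a||b|` (the tree's `norm_fderiv_fderiv_potential_scalar/vector_le` for a
  general kernel);
* `exists_bound_fderiv_fderiv_annularKernelDeriv`: third derivatives of the annular kernel,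
  `‖∂ₐ∂_b(∂_c k)‖ ≤ K|a||b||c|` (expansion of `b, c` in the standard basis);
* `fderiv_harmonicPart_apply_eq`: `∂ₐh = T(D(κₐ ⋆ d₁)) − curlCLM(D(κₐ ⋆ d₂))`, `κₐ = ∂ₐk` — the
  directional derivative of the harmonic part has the structure of the harmonic part itself
  with the kernel `∂ₐk` (symmetry of second derivatives, `∂ₐ(k ⋆ d) = (∂ₐk) ⋆ d`);
* `exists_norm_fderiv_fderiv_harmonicPart_apply_le`: **`‖D(∂ₐh)(x)‖ ≤ C |a| ∫_{B₂} |u|`** for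
  every `u ∈ L¹(B₂)`, `x`, `a` (stated on `∂ₐh` to avoid operator norms of iterated duals).

## Mathlib / tree search

Tree (reused): `harmonicPart`, `annularKernel`, `contDiff/hasCompactSupport_annularKernel`,
`scalar/vectorDensity`, `integrable_scalar/vectorDensity`, `contDiff_potential_scalar/vector`,
`fderiv_potential_scalar/vector_eq`, `integral_norm_scalar/vectorDensity_le`,
`exists_bound_gradient_kwonCutoff`, `norm_integral_comp_sub_smul_le` (`KwonHarmonicPart`);
`fderiv_convolution_lsmul_apply` (`HelmholtzAnnihilator`), `fderiv_convolution_apply_eq`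
(`MollifiedField`), `fderiv_apply_const_apply` (`PressurePoisson`), `curl_eq_curlCLM_comp`.
Mathlib: `ContDiffAt.isSymmSndFDerivAt`, `ContinuousLinearEquiv.comp_fderiv`,
`HasCompactSupport.contDiff_convolution_left`, `ContinuousLinearMap.opNorm_le_bound`.

## References

* H. Kwon, J. Differential Equations (2023) = arXiv:2104.03160: Remark 2.3 (2.4) and Lemma 2.5
  (est.h). [Kwon2023RolePressure]
-/

noncomputable section

open MeasureTheory Set Function Filter Topology TopologicalSpace Metric InnerProductSpace
  ContinuousLinearMap
open scoped NNReal ENNReal RealInnerProductSpace Convolution Laplacian ContDiff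

namespace Literature.Analysis.FluidPDE

namespace Kwon2023

variable {u : EuclideanSpace ℝ (Fin 3) → EuclideanSpace ℝ (Fin 3)}

/-! ### Second derivatives of a potential with a `C²_c` kernel -/

/-- **`‖D²(κ ⋆ g)(x)‖ ≤ K ‖g‖_{L¹}`** for a kernel `κ ∈ C²_c` with `‖∂ₐ∂_b κ‖ ≤ K|a||b|` and an
integrable density `g` (vector- or scalar-valued). [folklore] -/
theorem norm_fderiv_fderiv_convolution_le {F' : Type*} [NormedAddCommGroup F'] [NormedSpace ℝ F']
    [CompleteSpace F'] {κ : EuclideanSpace ℝ (Fin 3) → ℝ} (hκ : ContDiff ℝ 2 κ) (hκc : HasCompactSupport κ)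
    {K : ℝ} (hK0 : 0 ≤ K) (hK : ∀ z a b, ‖fderiv ℝ (fun w => fderiv ℝ κ w b) z a‖ ≤ K * ‖a‖ * ‖b‖)
    {g : EuclideanSpace ℝ (Fin 3) → F'} (hg : Integrable g) (x : EuclideanSpace ℝ (Fin 3)) :
    ‖fderiv ℝ (fderiv ℝ (κ ⋆[lsmul ℝ ℝ, volume] g)) x‖ ≤ K * ∫ y, ‖g y‖ := by
  have hI : 0 ≤ ∫ y, ‖g y‖ := integral_nonneg fun _ => norm_nonneg _
  have hG : ContDiff ℝ 2 (κ ⋆[lsmul ℝ ℝ, volume] g) := hκc.contDiff_convolution_left _ hκ hg.locallyIntegrable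
  have hdG : DifferentiableAt ℝ (fderiv ℝ (κ ⋆[lsmul ℝ ℝ, volume] g)) x :=
    ((hG.fderiv_right (m := 1) le_rfl).differentiable one_ne_zero) x
  refine ContinuousLinearMap.opNorm_le_bound _ (by positivity) fun a => ?_
  refine ContinuousLinearMap.opNorm_le_bound _ (by positivity) fun b => ?_
  have hκb : ContDiff ℝ 1 fun z => fderiv ℝ κ z b := (hκ.fderiv_right (m := 1) le_rfl).clm_apply contDiff_const
  have hκbc : HasCompactSupport fun z => fderiv ℝ κ z b := hκc.fderiv_apply (𝕜 := ℝ) b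
  have e : (fun y => fderiv ℝ (κ ⋆[lsmul ℝ ℝ, volume] g) y b) =
      ((fun z => fderiv ℝ κ z b) ⋆[lsmul ℝ ℝ, volume] g) :=
    funext fun y => fderiv_convolution_lsmul_apply (hκ.of_le one_le_two) hκc hg.locallyIntegrable y b
  rw [← fderiv_apply_const_apply hdG b a, e, fderiv_convolution_apply_eq hκb hκbc hg.locallyIntegrable x a]
  calc ‖∫ y, (fderiv ℝ (fun w => fderiv ℝ κ w b) (x - y) a) • g y‖
      ≤ K * ‖a‖ * ‖b‖ * ∫ y, ‖g y‖ :=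
        norm_integral_comp_sub_smul_le (k := fun z => fderiv ℝ (fun w => fderiv ℝ κ w b) z a)
          (fun z => hK z a b) hg x
    _ = K * (∫ y, ‖g y‖) * ‖a‖ * ‖b‖ := by ring

/-! ### Third derivatives of the annular kernel -/

/-- A uniform bound for the third derivatives of the annular kernel, through the kernels
`κ_c = ∂_c k`: `‖∂ₐ∂_b κ_c‖ ≤ K |a||b||c|`. [folklore] -/
theorem exists_bound_fderiv_fderiv_annularKernelDeriv :
    ∃ K : ℝ, 0 ≤ K ∧ ∀ (c z a b : EuclideanSpace ℝ (Fin 3)),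
      ‖fderiv ℝ (fun w => fderiv ℝ (fun v => fderiv ℝ annularKernel v c) w b) z a‖ ≤ K * ‖a‖ * ‖b‖ * ‖c‖ := by
  set e := EuclideanSpace.basisFun (Fin 3) ℝ with he
  -- the doubly-directional kernels `k_{ji} = ∂_{e_i} ∂_{e_j} k` are `C¹_c` with bounded derivative
  have hkj : ∀ j, ContDiff ℝ 3 fun v => fderiv ℝ annularKernel v (e j) := fun j =>
    ((contDiff_annularKernel (n := 4)).fderiv_right (m := 3) (by norm_num)).clm_apply contDiff_const
  have hkji : ∀ j i, ContDiff ℝ 1 fun w => fderiv ℝ (fun v => fderiv ℝ annularKernel v (e j)) w (e i) :=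
    fun j i => ((hkj j).fderiv_right (m := 1) (by norm_num)).clm_apply contDiff_const
  have hkjic : ∀ j i, HasCompactSupport fun w => fderiv ℝ (fun v => fderiv ℝ annularKernel v (e j)) w (e i) :=
    fun j i => (hasCompactSupport_annularKernel.fderiv_apply (𝕜 := ℝ) (e j)).fderiv_apply (𝕜 := ℝ) (e i)
  have hb : ∀ j i, ∃ K, 0 ≤ K ∧ ∀ z,
      ‖fderiv ℝ (fun w => fderiv ℝ (fun v => fderiv ℝ annularKernel v (e j)) w (e i)) z‖ ≤ K := fun j i => by
    obtain ⟨K, hK⟩ := ((hkji j i).continuous_fderiv one_ne_zero).bounded_above_of_compact_support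
      ((hkjic j i).fderiv (𝕜 := ℝ))
    exact ⟨max K 0, le_max_right _ _, fun z => (hK z).trans (le_max_left _ _)⟩
  choose K hK0 hK using hb
  refine ⟨∑ j, ∑ i, K j i, Finset.sum_nonneg fun j _ => Finset.sum_nonneg fun i _ => hK0 j i,
    fun c z a b => ?_⟩
  -- expand `c` and `b` in the standard basis
  have hexp : (fun w => fderiv ℝ (fun v => fderiv ℝ annularKernel v c) w b) =
      fun w => ∑ j, ∑ i, (c j * b i) • fderiv ℝ (fun v => fderiv ℝ annularKernel v (e j)) w (e i) := by
    funext w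
    have h1 : (fun v => fderiv ℝ annularKernel v c) = fun v => ∑ j, c j • fderiv ℝ annularKernel v (e j) := by
      funext v
      conv_lhs => rw [← (EuclideanSpace.basisFun (Fin 3) ℝ).sum_repr c]
      simp only [map_sum, map_smul, EuclideanSpace.basisFun_repr, smul_eq_mul, he]
    have hdj : ∀ j, DifferentiableAt ℝ (fun v => fderiv ℝ annularKernel v (e j)) w := fun j =>
      (hkj j).differentiable (by norm_num) w
    have hD1 : HasFDerivAt (fun v => ∑ j, c j • fderiv ℝ annularKernel v (e j))
        (∑ j, c j • fderiv ℝ (fun v => fderiv ℝ annularKernel v (e j)) w) w :=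
      HasFDerivAt.fun_sum fun j _ => (hdj j).hasFDerivAt.const_smul (c j)
    rw [h1, hD1.fderiv]
    simp only [FunLike.coe_sum, Finset.sum_apply, _root_.smul_apply]
    refine Finset.sum_congr rfl fun j _ => ?_
    conv_lhs => rw [← (EuclideanSpace.basisFun (Fin 3) ℝ).sum_repr b]
    simp only [map_sum, map_smul, EuclideanSpace.basisFun_repr, smul_eq_mul, he]
    rw [Finset.mul_sum]
    refine Finset.sum_congr rfl fun i _ => ?_
    ring
  have hdji : ∀ j i, DifferentiableAt ℝ (fun w => fderiv ℝ (fun v => fderiv ℝ annularKernel v (e j)) w (e i)) z :=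
    fun j i => (hkji j i).differentiable one_ne_zero z
  have hD : HasFDerivAt (fun w => ∑ j, ∑ i, (c j * b i) • fderiv ℝ (fun v => fderiv ℝ annularKernel v (e j)) w (e i))
      (∑ j, ∑ i, (c j * b i) • fderiv ℝ (fun w => fderiv ℝ (fun v => fderiv ℝ annularKernel v (e j)) w (e i)) z) z :=
    HasFDerivAt.fun_sum fun j _ => HasFDerivAt.fun_sum fun i _ => by
      simpa only [Pi.smul_def] using (hdji j i).hasFDerivAt.const_smul (c j * b i)
  rw [hexp, hD.fderiv]
  simp only [FunLike.coe_sum, Finset.sum_apply, _root_.smul_apply]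
  have hcj : ∀ j, |c j| ≤ ‖c‖ := fun j => by
    have := PiLp.norm_apply_le c j; rwa [Real.norm_eq_abs] at this
  have hbi : ∀ i, |b i| ≤ ‖b‖ := fun i => by
    have := PiLp.norm_apply_le b i; rwa [Real.norm_eq_abs] at this
  calc ‖∑ j, ∑ i, (c j * b i) • fderiv ℝ (fun w => fderiv ℝ (fun v => fderiv ℝ annularKernel v (e j)) w (e i)) z a‖
      ≤ ∑ j, ‖∑ i, (c j * b i) • fderiv ℝ (fun w => fderiv ℝ (fun v => fderiv ℝ annularKernel v (e j)) w (e i)) z a‖ :=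
        norm_sum_le _ _
    _ ≤ ∑ j, ∑ i, ‖(c j * b i) • fderiv ℝ (fun w => fderiv ℝ (fun v => fderiv ℝ annularKernel v (e j)) w (e i)) z a‖ :=
        Finset.sum_le_sum fun j _ => norm_sum_le _ _
    _ ≤ ∑ j, ∑ i, K j i * ‖a‖ * ‖b‖ * ‖c‖ := Finset.sum_le_sum fun j _ => Finset.sum_le_sum fun i _ => ?_
    _ = (∑ j, ∑ i, K j i) * ‖a‖ * ‖b‖ * ‖c‖ := by simp only [Finset.sum_mul]
  rw [norm_smul, Real.norm_eq_abs, abs_mul]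
  have h2 : ‖fderiv ℝ (fun w => fderiv ℝ (fun v => fderiv ℝ annularKernel v (e j)) w (e i)) z a‖ ≤ K j i * ‖a‖ :=
    (le_opNorm _ _).trans (mul_le_mul_of_nonneg_right (hK j i z) (norm_nonneg _))
  calc |c j| * |b i| * ‖fderiv ℝ (fun w => fderiv ℝ (fun v => fderiv ℝ annularKernel v (e j)) w (e i)) z a‖
      ≤ ‖c‖ * ‖b‖ * (K j i * ‖a‖) :=
        mul_le_mul (mul_le_mul (hcj j) (hbi i) (abs_nonneg _) (norm_nonneg _)) h2 (norm_nonneg _)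
          (mul_nonneg (norm_nonneg _) (norm_nonneg _))
    _ = K j i * ‖a‖ * ‖b‖ * ‖c‖ := by ring

/-! ### (est.h) at order two -/

/-- **The directional derivative of the harmonic part is again a harmonic part with the kernel
`∂ₐk`**: `∂ₐh(y) = ∇(∂ₐF)(y)… = T(D(κₐ ⋆ d₁)(y)) − curlCLM(D(κₐ ⋆ d₂)(y))`, `κₐ = ∂ₐk`
(symmetry of second derivatives). [folklore] -/
theorem fderiv_harmonicPart_apply_eq (hu : IntegrableOn u (ball (0 : EuclideanSpace ℝ (Fin 3)) 2))
    (y a : EuclideanSpace ℝ (Fin 3)) :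
    fderiv ℝ (harmonicPart u) y a =
      (InnerProductSpace.toDual ℝ (EuclideanSpace ℝ (Fin 3))).symm
          (fderiv ℝ ((fun z => fderiv ℝ annularKernel z a) ⋆ scalarDensity u) y)
        - curlCLM (fderiv ℝ ((fun z => fderiv ℝ annularKernel z a) ⋆[lsmul ℝ ℝ, volume] vectorDensity u) y) := by
  have hd₁ := integrable_scalarDensity hu
  have hd₂ := integrable_vectorDensity hu
  set F := annularKernel ⋆ scalarDensity u with hFdef
  set G := annularKernel ⋆[lsmul ℝ ℝ, volume] vectorDensity u with hGdef
  have hF : ContDiff ℝ 2 F := contDiff_potential_scalar hd₁.locallyIntegrable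
  have hG : ContDiff ℝ 2 G := contDiff_potential_vector hd₂.locallyIntegrable
  have hdF : DifferentiableAt ℝ (fderiv ℝ F) y := ((hF.fderiv_right (m := 1) le_rfl).differentiable one_ne_zero) y
  have hdG : DifferentiableAt ℝ (fderiv ℝ G) y := ((hG.fderiv_right (m := 1) le_rfl).differentiable one_ne_zero) y
  set T : StrongDual ℝ (EuclideanSpace ℝ (Fin 3)) ≃L[ℝ] EuclideanSpace ℝ (Fin 3) :=
    (InnerProductSpace.toDual ℝ (EuclideanSpace ℝ (Fin 3))).symm.toContinuousLinearEquiv with hT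
  have e1 : gradient F = T ∘ fderiv ℝ F := by funext w; rfl
  have hgrad : DifferentiableAt ℝ (gradient F) y := by rw [e1]; exact T.differentiableAt.comp y hdF
  have hcurl : DifferentiableAt ℝ (curl G) y :=
    (contDiff_curl (n := 1) hG).differentiable one_ne_zero y
  -- `D(∇F)(y) a = T (D²F(y) a)` and `D(curl G)(y) a = curlCLM (D²G(y) a)`
  have hA : fderiv ℝ (gradient F) y a = T (fderiv ℝ (fderiv ℝ F) y a) := by
    rw [e1, T.comp_fderiv]; rfl
  have hB : fderiv ℝ (curl G) y a = curlCLM (fderiv ℝ (fderiv ℝ G) y a) := by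
    rw [curl_eq_curlCLM_comp, (curlCLM.hasFDerivAt.comp y hdG.hasFDerivAt).fderiv]; rfl
  -- symmetry: `D²F(y) a = D(∂ₐF)(y)` as covectors, and `∂ₐF = κₐ ⋆ d₁`
  have hsF : fderiv ℝ (fderiv ℝ F) y a = fderiv ℝ ((fun z => fderiv ℝ annularKernel z a) ⋆ scalarDensity u) y := by
    ext c
    have hsym := (hF.contDiffAt (x := y)).isSymmSndFDerivAt (by simp) a c
    rw [← fderiv_potential_scalar_eq hd₁.locallyIntegrable a, fderiv_apply_const_apply hdF a c, ← hsym]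
  have hsG : fderiv ℝ (fderiv ℝ G) y a =
      fderiv ℝ ((fun z => fderiv ℝ annularKernel z a) ⋆[lsmul ℝ ℝ, volume] vectorDensity u) y := by
    ext c
    have hsym := (hG.contDiffAt (x := y)).isSymmSndFDerivAt (by simp) a c
    rw [← fderiv_potential_vector_eq hd₂.locallyIntegrable a, fderiv_apply_const_apply hdG a c, ← hsym]
  rw [show harmonicPart u = fun w => gradient F w - curl G w from rfl, fderiv_fun_sub hgrad hcurl,
    _root_.sub_apply, hA, hB, hsF, hsG]
  rfl

/-- **The second derivatives of the harmonic part are bounded by the `L¹(B₂)` norm of the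
velocity** (Kwon 2023, Lemma 2.5, (est.h) with `k = 2` at a fixed time, used for
`‖h‖_{W^{2,∞}}` in the estimate of `curl Δ⁻¹ curl(curl h × h φ♭)`; globally in `x`): there is an
absolute `C` with `‖D(∂ₐh)(x)‖ ≤ C |a| ∫_{B₂} |u|`. [cite: Kwon2023RolePressure, Lemma 2.5 (est.h)] -/
theorem exists_norm_fderiv_fderiv_harmonicPart_apply_le :
    ∃ C : ℝ, 0 ≤ C ∧ ∀ (u : EuclideanSpace ℝ (Fin 3) → EuclideanSpace ℝ (Fin 3)),
      IntegrableOn u (ball (0 : EuclideanSpace ℝ (Fin 3)) 2) →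
      ∀ x a, ‖fderiv ℝ (fun y => fderiv ℝ (harmonicPart u) y a) x‖ ≤
        C * ‖a‖ * ∫ y in ball (0 : EuclideanSpace ℝ (Fin 3)) 2, ‖u y‖ := by
  obtain ⟨K, hK0, hK⟩ := exists_bound_fderiv_fderiv_annularKernelDeriv
  obtain ⟨Cφ, hCφ0, hCφ⟩ := exists_bound_gradient_kwonCutoff
  refine ⟨(K + ‖curlCLM‖ * K) * Cφ, by positivity, fun u hu x a => ?_⟩
  have hd₁ := integrable_scalarDensity hu
  have hd₂ := integrable_vectorDensity hu
  have hI : 0 ≤ ∫ y in ball (0 : EuclideanSpace ℝ (Fin 3)) 2, ‖u y‖ := integral_nonneg fun _ => norm_nonneg _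
  set κ : EuclideanSpace ℝ (Fin 3) → ℝ := fun z => fderiv ℝ annularKernel z a with hκ
  have hκs : ContDiff ℝ 2 κ := ((contDiff_annularKernel (n := 3)).fderiv_right (m := 2) (by norm_num)).clm_apply contDiff_const
  have hκc : HasCompactSupport κ := hasCompactSupport_annularKernel.fderiv_apply (𝕜 := ℝ) a
  have hKa : ∀ z b c, ‖fderiv ℝ (fun w => fderiv ℝ κ w c) z b‖ ≤ K * ‖a‖ * ‖b‖ * ‖c‖ := fun z b c => by
    have := hK a z b c
    calc ‖fderiv ℝ (fun w => fderiv ℝ κ w c) z b‖ ≤ K * ‖b‖ * ‖c‖ * ‖a‖ := this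
      _ = K * ‖a‖ * ‖b‖ * ‖c‖ := by ring
  set P₁ := κ ⋆ scalarDensity u with hP₁
  set P₂ := κ ⋆[lsmul ℝ ℝ, volume] vectorDensity u with hP₂
  have hP₁s : ContDiff ℝ 2 P₁ := hκc.contDiff_convolution_left _ hκs hd₁.locallyIntegrable
  have hP₂s : ContDiff ℝ 2 P₂ := hκc.contDiff_convolution_left _ hκs hd₂.locallyIntegrable
  have hdP₁ : DifferentiableAt ℝ (fderiv ℝ P₁) x := ((hP₁s.fderiv_right (m := 1) le_rfl).differentiable one_ne_zero) x
  have hdP₂ : DifferentiableAt ℝ (fderiv ℝ P₂) x := ((hP₂s.fderiv_right (m := 1) le_rfl).differentiable one_ne_zero) x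
  set T : StrongDual ℝ (EuclideanSpace ℝ (Fin 3)) ≃L[ℝ] EuclideanSpace ℝ (Fin 3) :=
    (InnerProductSpace.toDual ℝ (EuclideanSpace ℝ (Fin 3))).symm.toContinuousLinearEquiv with hT
  have e : (fun y => fderiv ℝ (harmonicPart u) y a) = fun y => T (fderiv ℝ P₁ y) - curlCLM (fderiv ℝ P₂ y) := by
    funext y; rw [fderiv_harmonicPart_apply_eq hu y a]; rfl
  have h1d : DifferentiableAt ℝ (fun y => T (fderiv ℝ P₁ y)) x := T.differentiableAt.comp x hdP₁
  have h2d : DifferentiableAt ℝ (fun y => curlCLM (fderiv ℝ P₂ y)) x := curlCLM.differentiableAt.comp x hdP₂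
  have h1 : ‖fderiv ℝ (fun y => T (fderiv ℝ P₁ y)) x‖ ≤ K * ‖a‖ * ∫ y, ‖scalarDensity u y‖ := by
    rw [show (fun y => T (fderiv ℝ P₁ y)) = T ∘ fderiv ℝ P₁ from rfl, T.comp_fderiv]
    refine ContinuousLinearMap.opNorm_le_bound _ (by positivity) fun b => ?_
    rw [ContinuousLinearMap.comp_apply]
    have : ‖(T : StrongDual ℝ (EuclideanSpace ℝ (Fin 3)) →L[ℝ] EuclideanSpace ℝ (Fin 3))
        (fderiv ℝ (fderiv ℝ P₁) x b)‖ = ‖fderiv ℝ (fderiv ℝ P₁) x b‖ :=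
      (InnerProductSpace.toDual ℝ (EuclideanSpace ℝ (Fin 3))).symm.norm_map _
    rw [this]
    calc ‖fderiv ℝ (fderiv ℝ P₁) x b‖ ≤ ‖fderiv ℝ (fderiv ℝ P₁) x‖ * ‖b‖ := le_opNorm _ _
      _ ≤ (K * ‖a‖ * ∫ y, ‖scalarDensity u y‖) * ‖b‖ :=
          mul_le_mul_of_nonneg_right (norm_fderiv_fderiv_convolution_le hκs hκc (by positivity) hKa hd₁ x)
            (norm_nonneg _)
  have h2 : ‖fderiv ℝ (fun y => curlCLM (fderiv ℝ P₂ y)) x‖ ≤ ‖curlCLM‖ * (K * ‖a‖ * ∫ y, ‖vectorDensity u y‖) := by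
    rw [show fderiv ℝ (fun y => curlCLM (fderiv ℝ P₂ y)) x = curlCLM.comp (fderiv ℝ (fderiv ℝ P₂) x) from
      (curlCLM.hasFDerivAt.comp x hdP₂.hasFDerivAt).fderiv]
    calc ‖curlCLM.comp (fderiv ℝ (fderiv ℝ P₂) x)‖ ≤ ‖curlCLM‖ * ‖fderiv ℝ (fderiv ℝ P₂) x‖ := opNorm_comp_le _ _
      _ ≤ ‖curlCLM‖ * (K * ‖a‖ * ∫ y, ‖vectorDensity u y‖) :=
          mul_le_mul_of_nonneg_left (norm_fderiv_fderiv_convolution_le hκs hκc (by positivity) hKa hd₂ x)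
            (norm_nonneg curlCLM)
  have h3 := integral_norm_scalarDensity_le hCφ hu
  have h4 := integral_norm_vectorDensity_le hCφ hu
  rw [e, fderiv_fun_sub h1d h2d]
  calc ‖fderiv ℝ (fun y => T (fderiv ℝ P₁ y)) x - fderiv ℝ (fun y => curlCLM (fderiv ℝ P₂ y)) x‖
      ≤ ‖fderiv ℝ (fun y => T (fderiv ℝ P₁ y)) x‖ + ‖fderiv ℝ (fun y => curlCLM (fderiv ℝ P₂ y)) x‖ := norm_sub_le _ _
    _ ≤ K * ‖a‖ * (Cφ * ∫ y in ball (0 : EuclideanSpace ℝ (Fin 3)) 2, ‖u y‖) +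
          ‖curlCLM‖ * (K * ‖a‖ * (Cφ * ∫ y in ball (0 : EuclideanSpace ℝ (Fin 3)) 2, ‖u y‖)) := by
        gcongr
        · exact h1.trans (mul_le_mul_of_nonneg_left h3 (by positivity))
        · exact h2.trans (mul_le_mul_of_nonneg_left (mul_le_mul_of_nonneg_left h4 (by positivity))
            (norm_nonneg curlCLM))
    _ = (K + ‖curlCLM‖ * K) * Cφ * ‖a‖ * ∫ y in ball (0 : EuclideanSpace ℝ (Fin 3)) 2, ‖u y‖ := by ring

end Kwon2023

end Literature.Analysis.FluidPDE

end
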